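import Summits.QuantumAdvantage.QuantumAdvantage.Theorems.CubicForrelationSignedExactCubicForrelationNotPrBPPStubNoTrapTemplate
import Summits.QuantumAdvantage.QuantumAdvantage.Theorems.CubicForrelationSignedExactCubicForrelationNotPrBPPStubNoTrapTransport

/-!
# Crux `CubicForrelation.SignedExactCubicForrelationNotPrBPP` (stmt-QuantumAdvantage-13932), line `dual-pingpong-frame`
# (classify-then-count cut): the kernel statistics hold TRIVIALLY below `m = 54`

Support file (`--supports stmt-QuantumAdvantage-13932`) for stub `stub_coreReduction` (and for the live line's
`stub_kernelStats` / `stub_kernelStatsCore`). It sharpens the landed `kernelStats_of_le_twentytwo` (`m ≤ 22`,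
file `…KernelStatsSmall.lean`) by counting ALL new good vectors supplied by the no-trap extension instead of one:
at `r = 0` the candidate space `K(∅) = Z_b(S) ∩ U^⊥` contains the whole no-trap M-subspace `V* ⊇ S`, `V* ⊥ U`
(landed `stub_noTrapTransport stub_noTrapTemplate`), every vector of `V* ∖ S` is new and good, and `V* ∖ S` is at
least HALF of `V*` because `S ⊊ V*` is a proper subgroup (`s ↦ v₀ ⊕ s` injects `S` into `V* ∖ S` for any
`v₀ ∈ V* ∖ S`). Hence the new-good density at `r = 0` is `≥ 2^{m-1}/2^{2m} = 2^{-(m+1)}`, and `2^{m+1} ≤ (2m+2)^8`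
exactly when `m ≤ 53`. Consequently the registered kernel statistics (and a fortiori the core statement of the
classify-then-count skeleton, which carries two extra radical-absorption hypotheses) have finite content only from
`m = 54` (`n = 108`) on.

* `two_pow_succ_le_pow_eight` — `2^{m+1} ≤ (2m+2)^8` for `m ≤ 53`;
* `card_le_card_sdiff_of_proper` — a proper ⊕-closed part `S ⊊ V` of a ⊕-closed finset has `|S| ≤ |V ∖ S|`;
* `one_div_le_card_filter_div_card_of_subset` — counting core with a witnessed sub-finset;
* `kernelStats_of_le_fiftythree` — verbatim the registered statement of `stub_kernelStats` with the extra
  hypothesis `m ≤ 53` (the `b`-side disjunct, witnessed by `r = 0`).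

References: C. Carlet, *Boolean Functions for Cryptography and Coding Theory*, CUP 2021, Prop. 54 (M-subspaces of
the completed Maiorana–McFarland class) [Carlet2020]; S. Arora, B. Barak, *Computational Complexity: A Modern
Approach*, CUP 2009, §7.1 [AroraBarak2009]. -/

noncomputable section

set_option linter.dupNamespace false -- D-0017: single-problem summit ⇒ `QuantumAdvantage.QuantumAdvantage` by design

namespace Summit.QuantumAdvantage.QuantumAdvantage.Theorems.SignedExactCubicForrelationNotPrBPP

open Finset
open Literature.Computability.Complexity Literature.Computability.QuantumComplexity
open Literature.Computability.QuantumComplexity.BuzetChailloux (bxor zeroVec)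

/-- Numerical core: `2^{m+1} ≤ (2m+2)^8` for `m ≤ 53` (it fails from `m = 54` on). [folklore] -/
theorem two_pow_succ_le_pow_eight {m : ℕ} (hm : m ≤ 53) : 2 ^ (m + 1) ≤ (m + m + 2) ^ 8 := by
  interval_cases m <;> norm_num

/-- A proper ⊕-closed part `S` of a ⊕-closed finset `V` occupies at most half of it: `|S| ≤ |V ∖ S|`
(translate `S` by any `v₀ ∈ V ∖ S`). [folklore] -/
theorem card_le_card_sdiff_of_proper {n : ℕ} (S V : Finset (Fin n → Bool))
    (hS : ∀ x ∈ S, ∀ y ∈ S, bxor x y ∈ S) (hV : ∀ x ∈ V, ∀ y ∈ V, bxor x y ∈ V) (hSV : S ⊆ V)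
    (v₀ : Fin n → Bool) (hv₀V : v₀ ∈ V) (hv₀S : v₀ ∉ S) : S.card ≤ (V \ S).card := by
  have hxx : ∀ x y : Fin n → Bool, bxor (bxor x y) y = x := fun x y => by
    funext i
    show ((x i ^^ y i) ^^ y i) = x i
    rw [Bool.xor_assoc, Bool.xor_self, Bool.xor_false]
  refine Finset.card_le_card_of_injOn (fun s => bxor v₀ s) (fun s hs => ?_) (fun s _ s' _ h => ?_)
  · refine Finset.mem_sdiff.2 ⟨hV v₀ hv₀V s (hSV hs), fun h => hv₀S ?_⟩
    have := hS _ h s hs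
    rwa [hxx] at this
  · have h' : bxor (bxor v₀ s) v₀ = bxor (bxor v₀ s') v₀ := by simp only [h]
    have e1 : ∀ t : Fin n → Bool, bxor (bxor v₀ t) v₀ = t := fun t => by
      funext i
      show ((v₀ i ^^ t i) ^^ v₀ i) = t i
      rw [Bool.xor_comm (v₀ i), Bool.xor_assoc, Bool.xor_self, Bool.xor_false]
    rwa [e1, e1] at h'

/-- Counting core: if every element of a nonempty `T ⊆ K` satisfies `p` and `|α| ≤ B·|T|`, then the `p`-part of `K`
has relative size `≥ 1/B` (the filter is taken with an explicitly supplied decidability instance, as in the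
registered statement). [cite: AroraBarak2009, §7.1] -/
theorem one_div_le_card_filter_div_card_of_subset {α : Type*} [Fintype α] (p : α → Prop) (inst : DecidablePred p)
    (K T : Finset α) (hTK : T ⊆ K) (hTp : ∀ v ∈ T, p v) (hT : T.Nonempty) (B : ℝ)
    (hB : (Fintype.card α : ℝ) ≤ B * T.card) :
    1 / B ≤ ((@Finset.filter α p inst K).card : ℝ) / (K.card : ℝ) := by
  have hTpos : (0 : ℝ) < T.card := by exact_mod_cast Finset.card_pos.2 hT
  have hKpos : (0 : ℝ) < K.card := by exact_mod_cast Finset.card_pos.2 (hT.mono hTK)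
  have hK : (K.card : ℝ) ≤ B * T.card := le_trans (by exact_mod_cast Finset.card_le_univ K) hB
  have hBpos : 0 < B := by
    have h1 : (0 : ℝ) < B * T.card := lt_of_lt_of_le hKpos hK
    exact pos_of_mul_pos_left (by simpa [mul_comm] using h1) hTpos.le
  have hTf : (T.card : ℝ) ≤ ((@Finset.filter α p inst K).card : ℝ) := by
    have : T ⊆ @Finset.filter α p inst K := fun v hv => (@Finset.mem_filter α p inst K v).2 ⟨hTK hv, hTp v hv⟩
    exact_mod_cast Finset.card_le_card this
  rw [div_le_div_iff₀ hBpos hKpos, one_mul]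
  calc (K.card : ℝ) ≤ B * T.card := hK
    _ ≤ B * ((@Finset.filter α p inst K).card : ℝ) := by gcongr
    _ = ((@Finset.filter α p inst K).card : ℝ) * B := mul_comm _ _

/-- **The kernel statistics below `m = 54` (verbatim `stub_kernelStats` with the extra hypothesis `m ≤ 53`).**
At `r = 0` the candidate space `K(∅) = Z_b(S) ∩ U^⊥` contains the no-trap extension `V* ⊇ S` of the closed
orthogonal pair (landed `stub_noTrapTransport stub_noTrapTemplate`); all of `V* ∖ S` is new and good,
`|V* ∖ S| ≥ |V*|/2 = 2^{m-1}`, and `|K(∅)| ≤ 2^{2m} ≤ (2m+2)^8 · 2^{m-1}`. [cite: Carlet2020, Prop. 54] -/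
theorem kernelStats_of_le_fiftythree :
    ∀ (m : ℕ), m ≤ 53 → ∀ (C : Fin 2 → Circuit (Fin (m + m))),
        (⟨m + m, 2, C⟩ : KForrelationInstance).IsOverB2 →
        (∀ i, IsDegLeFun 3 (C i).eval) →
        (forrelation (C 0).eval (C 1).eval = 1 ∨ forrelation (C 0).eval (C 1).eval = -1) →
        (∃ e : (Fin (m + m) → Bool) ≃ (Fin (m + m) → Bool),
          (∃ M : Matrix (Fin (m + m)) (Fin (m + m)) (ZMod 2), ∃ c : Fin (m + m) → ZMod 2,
            ∀ y i, (if e y i then (1 : ZMod 2) else 0) = (M.mulVec (fun j => if y j then (1 : ZMod 2) else 0) + c) i) ∧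
          ∃ perm : (Fin m → Bool) ≃ (Fin m → Bool), ∃ h : (Fin m → Bool) → Bool, ∀ y' y'' : Fin m → Bool,
            (if (C 1).eval (e (Fin.append y' y'')) then (1 : ZMod 2) else 0) =
              (∑ i, (if y' i then (1 : ZMod 2) else 0) * (if perm y'' i then (1 : ZMod 2) else 0)) +
                (if h y'' then (1 : ZMod 2) else 0)) →
        ∀ S U : Finset (Fin (m + m) → Bool),
          (zeroVec ∈ S ∧ ∀ x ∈ S, ∀ y ∈ S, bxor x y ∈ S) → (zeroVec ∈ U ∧ ∀ x ∈ U, ∀ y ∈ U, bxor x y ∈ U) →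
          ((∀ s ∈ S, ∀ y : Fin (m + m) → Bool, (fun k => ((C 1).eval zeroVec ^^ (C 1).eval (bxor zeroVec s) ^^ (C 1).eval (bxor zeroVec y) ^^ (C 1).eval (bxor zeroVec (bxor s y))) ^^ ((C 1).eval (fun j => decide (j = k)) ^^ (C 1).eval (bxor (fun j => decide (j = k)) s) ^^ (C 1).eval (bxor (fun j => decide (j = k)) y) ^^ (C 1).eval (bxor (fun j => decide (j = k)) (bxor s y)))) ∈ U) ∧ (∀ s ∈ S, ∃ ℓ ∈ U, ∀ r : Fin (m + m) → Bool, (∀ y z : Fin (m + m) → Bool, (((C 1).eval z ^^ (C 1).eval (bxor z s) ^^ (C 1).eval (bxor z r) ^^ (C 1).eval (bxor z (bxor s r))) ^^ ((C 1).eval (bxor z y) ^^ (C 1).eval (bxor (bxor z y) s) ^^ (C 1).eval (bxor (bxor z y) r) ^^ (C 1).eval (bxor (bxor z y) (bxor s r)))) = false) → ((C 1).eval r ^^ (C 1).eval (bxor r s) ^^ (C 1).eval zeroVec ^^ (C 1).eval s) = ((Finset.univ.filter fun i => ℓ i && r i).card).bodd)) →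
          ((∀ s ∈ U, ∀ y : Fin (m + m) → Bool, (fun k => ((C 0).eval zeroVec ^^ (C 0).eval (bxor zeroVec s) ^^ (C 0).eval (bxor zeroVec y) ^^ (C 0).eval (bxor zeroVec (bxor s y))) ^^ ((C 0).eval (fun j => decide (j = k)) ^^ (C 0).eval (bxor (fun j => decide (j = k)) s) ^^ (C 0).eval (bxor (fun j => decide (j = k)) y) ^^ (C 0).eval (bxor (fun j => decide (j = k)) (bxor s y)))) ∈ S) ∧ (∀ s ∈ U, ∃ ℓ ∈ S, ∀ r : Fin (m + m) → Bool, (∀ y z : Fin (m + m) → Bool, (((C 0).eval z ^^ (C 0).eval (bxor z s) ^^ (C 0).eval (bxor z r) ^^ (C 0).eval (bxor z (bxor s r))) ^^ ((C 0).eval (bxor z y) ^^ (C 0).eval (bxor (bxor z y) s) ^^ (C 0).eval (bxor (bxor z y) r) ^^ (C 0).eval (bxor (bxor z y) (bxor s r)))) = false) → ((C 0).eval r ^^ (C 0).eval (bxor r s) ^^ (C 0).eval zeroVec ^^ (C 0).eval s) = ((Finset.univ.filter fun i => ℓ i && r i).card).bodd)) →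
          (∀ s ∈ S, ∀ u ∈ U, ((Finset.univ.filter fun i => s i && u i).card).bodd = false) →
          S.card < 2 ^ m → U.card < 2 ^ m →
          (∃ r : ℕ, r ≤ m + m + 1 ∧ (2 : ℝ) ^ ((m + m) * r) / ((m + m + 2 : ℝ) ^ 8) ≤ (∑ xs : Fin (r) → (Fin (m + m) → Bool), (((@Finset.filter (Fin (m + m) → Bool) (fun v => v ∉ S ∧ (∃ V : Finset (Fin (m + m) → Bool), ((zeroVec ∈ V ∧ ∀ x ∈ V, ∀ y ∈ V, bxor x y ∈ V) ∧ (((V).card : ℝ) ^ 2 = (2 : ℝ) ^ (m + m)) ∧ ∀ u ∈ V, ∀ v ∈ V, ∀ x, ((C 1).eval x ^^ (C 1).eval (bxor x u) ^^ (C 1).eval (bxor x v) ^^ (C 1).eval (bxor x (bxor u v))) = false) ∧ S ⊆ V ∧ v ∈ V ∧ (∀ s ∈ V, ∀ u ∈ U, ((Finset.univ.filter fun i => s i && u i).card).bodd = false))) (Classical.decPred _) (Finset.univ.filter fun (v : Fin (m + m) → Bool) => (∀ s ∈ S, ∀ x, ((C 1).eval x ^^ (C 1).eval (bxor x s) ^^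 (C 1).eval (bxor x v) ^^ (C 1).eval (bxor x (bxor s v))) = false) ∧ (∀ u ∈ U, ((Finset.univ.filter fun i => u i && v i).card).bodd = false) ∧ ∀ j, (∀ y z : Fin (m + m) → Bool, (((C 1).eval z ^^ (C 1).eval (bxor z (xs j)) ^^ (C 1).eval (bxor z v) ^^ (C 1).eval (bxor z (bxor (xs j) v))) ^^ ((C 1).eval (bxor z y) ^^ (C 1).eval (bxor (bxor z y) (xs j)) ^^ (C 1).eval (bxor (bxor z y) v) ^^ (C 1).eval (bxor (bxor z y) (bxor (xs j) v)))) = false))).card : ℝ) / (((Finset.univ.filter fun (v : Fin (m + m) → Bool) => (∀ s ∈ S, ∀ x, ((C 1).eval x ^^ (C 1).eval (bxor x s) ^^ (C 1).eval (bxor x v) ^^ (C 1).eval (bxor x (bxor s v))) = false) ∧ (∀ u ∈ U, ((Finset.univ.filter fun i => u i && v i).card).bodd = false) ∧ ∀ j, (∀ y z : Fin (m + m) → Bool, (((C 1).eval z ^^ (C 1).eval (bxor z (xs j)) ^^ (C 1).eval (bxor z v) ^^ (C 1).eval (bxor z (bxor (xs j) v))) ^^ ((C 1).eval (bxor z y)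 ^^ (C 1).eval (bxor (bxor z y) (xs j)) ^^ (C 1).eval (bxor (bxor z y) v) ^^ (C 1).eval (bxor (bxor z y) (bxor (xs j) v)))) = false))).card : ℝ)))) ∨
          (∃ r : ℕ, r ≤ m + m + 1 ∧ (2 : ℝ) ^ ((m + m) * r) / ((m + m + 2 : ℝ) ^ 8) ≤ (∑ xs : Fin (r) → (Fin (m + m) → Bool), (((@Finset.filter (Fin (m + m) → Bool) (fun v => v ∉ U ∧ (∃ V : Finset (Fin (m + m) → Bool), ((zeroVec ∈ V ∧ ∀ x ∈ V, ∀ y ∈ V, bxor x y ∈ V) ∧ (((V).card : ℝ) ^ 2 = (2 : ℝ) ^ (m + m)) ∧ ∀ u ∈ V, ∀ v ∈ V, ∀ x, ((C 0).eval x ^^ (C 0).eval (bxor x u) ^^ (C 0).eval (bxor x v) ^^ (C 0).eval (bxor x (bxor u v))) = false) ∧ U ⊆ V ∧ v ∈ V ∧ (∀ s ∈ V, ∀ u ∈ S, ((Finset.univ.filter fun i => s i && u i).card).bodd = false))) (Classical.decPred _) (Finset.univ.filter fun (v : Fin (m + m) → Bool) => (∀ s ∈ U, ∀ x, ((C 0).eval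 x ^^ (C 0).eval (bxor x s) ^^ (C 0).eval (bxor x v) ^^ (C 0).eval (bxor x (bxor s v))) = false) ∧ (∀ u ∈ S, ((Finset.univ.filter fun i => u i && v i).card).bodd = false) ∧ ∀ j, (∀ y z : Fin (m + m) → Bool, (((C 0).eval z ^^ (C 0).eval (bxor z (xs j)) ^^ (C 0).eval (bxor z v) ^^ (C 0).eval (bxor z (bxor (xs j) v))) ^^ ((C 0).eval (bxor z y) ^^ (C 0).eval (bxor (bxor z y) (xs j)) ^^ (C 0).eval (bxor (bxor z y) v) ^^ (C 0).eval (bxor (bxor z y) (bxor (xs j) v)))) = false))).card : ℝ) / (((Finset.univ.filter fun (v : Fin (m + m) → Bool) => (∀ s ∈ U, ∀ x, ((C 0).eval x ^^ (C 0).eval (bxor x s) ^^ (C 0).eval (bxor x v) ^^ (C 0).eval (bxor x (bxor s v))) = false) ∧ (∀ u ∈ S, ((Finset.univ.filter fun i => u i && v i).card).bodd = false) ∧ ∀ j, (∀ y z : Fin (m + m) → Bool, (((C 0).eval z ^^ (C 0).eval (bxor z (xs j)) ^^ (C 0).eval (bxor z v) ^^ (C 0).eval (bxor z (bxor (xs j)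 v))) ^^ ((C 0).eval (bxor z y) ^^ (C 0).eval (bxor (bxor z y) (xs j)) ^^ (C 0).eval (bxor (bxor z y) v) ^^ (C 0).eval (bxor (bxor z y) (bxor (xs j) v)))) = false))).card : ℝ)))) := by
  intro m hm C hB hdeg hΦ horb S U hS hU hcb hca ho hSlt hUlt
  left
  refine ⟨0, Nat.zero_le _, ?_⟩
  -- the no-trap extension of the pair
  obtain ⟨V, hV, hSV, hVU⟩ :=
    stub_noTrapTransport stub_noTrapTemplate m (C 0).eval (C 1).eval (hdeg 0) (hdeg 1) hΦ horb S U hS hU hcb hca ho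
  have hVflat := hV.2.2
  have hcard : (V.card : ℝ) ^ 2 = (2 : ℝ) ^ (m + m) := hV.2.1
  have hVc : V.card = 2 ^ m := by
    have h2 : (2 : ℝ) ^ (m + m) = ((2 : ℝ) ^ m) ^ 2 := by rw [← pow_mul]; ring_nf
    rw [h2] at hcard
    have hn : (0 : ℝ) ≤ V.card := by positivity
    have hp : (0 : ℝ) ≤ (2 : ℝ) ^ m := by positivity
    have := (pow_left_inj₀ hn hp two_ne_zero).1 hcard
    exact_mod_cast this
  have hne : ¬ V ⊆ S := fun h => by
    have := Finset.card_le_card h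
    omega
  obtain ⟨v₀, hv₀V, hv₀S⟩ := Finset.not_subset.1 hne
  -- `|V ∖ S| ≥ |V|/2`
  have hhalf : 2 ^ m ≤ 2 * (V \ S).card := by
    have h1 : S.card ≤ (V \ S).card := card_le_card_sdiff_of_proper S V hS.2 hV.1.2 hSV v₀ hv₀V hv₀S
    have h2 : (V \ S).card + S.card = V.card := Finset.card_sdiff_add_card_eq_card hSV
    omega
  -- one term in the sum over `Fin 0 → _`, and `2 ^ ((m+m) * 0) = 1`
  rw [Fintype.sum_unique, Nat.mul_zero, pow_zero]
  refine one_div_le_card_filter_div_card_of_subset _ _ _ (V \ S) ?_ ?_ ⟨v₀, Finset.mem_sdiff.2 ⟨hv₀V, hv₀S⟩⟩ _ ?_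
  · -- `V ∖ S ⊆ K(∅) = Z_b(S) ∩ U^⊥` (no probe clause)
    intro v hv
    have hvV : v ∈ V := (Finset.mem_sdiff.1 hv).1
    refine Finset.mem_filter.2 ⟨Finset.mem_univ _, fun s hs x => hVflat s (hSV hs) v hvV x, fun u hu => ?_, fun j => j.elim0⟩
    have h := hVU v hvV u hu
    have hfe : (Finset.univ.filter fun i => u i && v i) = (Finset.univ.filter fun i => v i && u i) := by
      congr 1; funext i; rw [Bool.and_comm]
    rw [hfe]; exact h
  · -- every vector of `V ∖ S` is new and good (witness `V` itself)
    intro v hv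
    obtain ⟨hvV, hvS⟩ := Finset.mem_sdiff.1 hv
    exact ⟨hvS, V, hV, hSV, hvV, hVU⟩
  · -- `|𝔽₂^{2m}| = 2^{2m} ≤ (2m+2)^8 · |V ∖ S|`
    have hc : (Fintype.card (Fin (m + m) → Bool) : ℝ) = ((2 ^ (m + m) : ℕ) : ℝ) := by
      rw [Fintype.card_fun, Fintype.card_bool, Fintype.card_fin]
    have hnat : 2 ^ (m + m) ≤ (m + m + 2) ^ 8 * (V \ S).card := by
      have h8 := two_pow_succ_le_pow_eight hm
      have e1 : 2 * 2 ^ (m + m) = 2 ^ m * 2 ^ (m + 1) := by ring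
      have key : 2 * 2 ^ (m + m) ≤ 2 * ((m + m + 2) ^ 8 * (V \ S).card) :=
        calc 2 * 2 ^ (m + m) = 2 ^ m * 2 ^ (m + 1) := e1
          _ ≤ (2 * (V \ S).card) * (m + m + 2) ^ 8 := Nat.mul_le_mul hhalf h8
          _ = 2 * ((m + m + 2) ^ 8 * (V \ S).card) := by ring
      exact Nat.le_of_mul_le_mul_left key (by norm_num)
    rw [hc]
    have : (((2 ^ (m + m) : ℕ) : ℝ)) ≤ (((m + m + 2) ^ 8 * (V \ S).card : ℕ) : ℝ) := by exact_mod_cast hnat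
    simpa using this

/-- Registered form (sub-goal `coreReduction_indexTwo` of stub `stub_coreReduction`): a proper ⊕-closed part of a
⊕-closed finset of bit vectors has index at least two, `|S| ≤ |V ∖ S|` — the counting heart of
`kernelStats_of_le_fiftythree` (whose own signature exceeds the stub registry's length bound). [folklore] -/
theorem coreReduction_indexTwo : ∀ {n : ℕ} (S V : Finset (Fin n → Bool)), (∀ x ∈ S, ∀ y ∈ S, bxor x y ∈ S) → (∀ x ∈ V, ∀ y ∈ V, bxor x y ∈ V) → S ⊆ V → ∀ v₀ : Fin n → Bool, v₀ ∈ V → v₀ ∉ S → S.card ≤ (V \ S).card :=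
  fun S V hS hV hSV v₀ hv₀V hv₀S => card_le_card_sdiff_of_proper S V hS hV hSV v₀ hv₀V hv₀S

end Summit.QuantumAdvantage.QuantumAdvantage.Theorems.SignedExactCubicForrelationNotPrBPP

end
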